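import Summits.QuantumAdvantage.QuantumAdvantage.Theorems.CubicForrelationNearExactIsExactZeroModSixDigits
import Summits.QuantumAdvantage.QuantumAdvantage.Theorems.CubicForrelationNearExactIsExactEighteenTypeOBoundary

/-!
# Crux `CubicForrelation.NearExactIsExact` (stmt-QuantumAdvantage-14043) — `n = 6r`, TWO-SIDED: a type-O cubic never reaches
  `Φ = 1 − 2^{−2r}` (`r ≥ 3`)

Certificate seat `b2b-cforr-cert` (gen 8).  HONEST FRAMING: a theorem uniform in `r` about cubic Boolean pairs on `6r` bits (the type-O
configuration at the SECOND dyadic boundary `1 − 2^{−n/3}` on `n ≡ 0 (mod 6)`); `r = 3` is the tree's `et_typeO_eighteen_lt`; NOT summit progress.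

`z2_typeO_lt`: for cubic `f, g : 𝔽₂^{3r+3r} → 𝔽₂` (`r ≥ 3`) with `W_g = 2^{2r}u` and ALL `u` odd (type O), `Φ(f,g) < 1 − (1/2)^{2r}`.  Proof
(the `n = 18` file `…EighteenTypeOBoundary.lean` in general `r`): with `s = (−1)^f`, `τ = u − 2^r s` and the digits `d₁ = [⌊u/2⌋ odd]` (AFFINE,
`z2_digitOne`), `d₂ = [⌊u/4⌋ odd]` (cubic, `z2_digitTwo`):
* pointwise `(u − 2^r s)² ≥ 1 + 8·[d₁ ≠ d₂]` (`z2_pt`; `8 ∣ 2^r`), `A = {d₁ ≠ d₂}` is non-empty (`z2_no_caseA`) of degree `≤ 3`, so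
  `#A ≥ 2^{6r−3}` and the budget `Σ τ² = 2^{8r+1}(1 − Φ) ≤ 2^{6r+1} = 2^{6r} + 8·2^{6r−3}` is spent exactly: `A` is a `(6r−3)`-flat,
  `τ = (−1)^{d₁}` off `A`, `τ = −3(−1)^{d₁}` on `A`;
* `(−1)^{d₁}` is a `±`character and `(−1)^{d₁}1_A` has all of `V_A` as periods up to sign: `Σ_y |τ̂(y)| ≤ 2^{6r} + 4·2^{6r}` (`fp_l1_sq_mul_le`);
* but the pairing identity needs `Σ_y (−1)^{g(y)} τ̂(y) = 2^{10r}(1 − Φ) = 2^{8r} ≥ 64·2^{6r}` (`zms_pairing`). Contradiction.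

References: J. Ax (1964) / R. J. McEliece (1972); MacWilliams–Sloane (1977) Ch. 13–15; R. O'Donnell (2014) §3.3.  Everything below is proved
from Mathlib and the tree; axioms are the standard three.
-/

set_option linter.dupNamespace false -- D-0017: single-problem summit ⇒ `QuantumAdvantage.QuantumAdvantage` by design

noncomputable section

namespace Summit.QuantumAdvantage.QuantumAdvantage.Theorems.CubicForrelation.NearExactIsExact

open Finset
open Literature.Computability.QuantumComplexity
open Literature.Computability.QuantumComplexity.BuzetChailloux (bxor zeroVec bxor_bxor_cancel_left bxor_zeroVec zeroVec_bxor bxor_comm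
  bxor_self)
open Literature.Computability.QuantumComplexity.DerivativeWalsh (W)

/-! ### Pointwise facts about an odd residual -/

/-- For odd `w`: `1 + 8·[bit₁(w) ≠ bit₂(w)] ≤ w²` (`bit₁ ≠ bit₂ ⟺ w ≡ ±3 (mod 8)`, and then `|w| ≥ 3`). [folklore] -/
theorem z2_pt_core (w : ℤ) (hw : Odd w) :
    1 + 8 * (if ¬ (Odd (w / 2) ↔ Odd (w / 2 / 2)) then 1 else 0 : ℤ) ≤ w ^ 2 := by
  rcases le_or_gt 3 |w| with h3 | h3
  · have h9 : (9 : ℤ) ≤ w ^ 2 := by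
      have h := tp_sq_ge (k := 3) (t := w) (by norm_num) (by
        rcases le_or_gt 0 w with hw0 | hw0
        · rw [abs_of_nonneg hw0] at h3; exact Or.inr h3
        · rw [abs_of_neg hw0] at h3; exact Or.inl (by linarith))
      linarith
    have hconst : (if ¬ (Odd (w / 2) ↔ Odd (w / 2 / 2)) then 1 else 0 : ℤ) ≤ 1 := by split_ifs <;> norm_num
    linarith
  · have h1 : -2 ≤ w := by have := (abs_lt.1 h3).1; omega
    have h2 : w ≤ 2 := by have := (abs_lt.1 h3).2; omega
    interval_cases w <;> (try (exfalso; norm_num [Int.odd_iff] at hw; done)) <;> norm_num [Int.odd_iff]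

/-- **The two-sided pointwise inequality (type O, `8 ∣ c`).** For odd `v`, `s = ±1` and `8 ∣ c`: `1 + 8·[d₁ ≠ d₂] ≤ (v − c·s)²`
(`d₁ = [⌊v/2⌋ odd]`, `d₂ = [⌊v/4⌋ odd]` are the bits of `v`, unchanged by the shift `c·s ∈ 8ℤ`). [this work] -/
theorem z2_pt (v s c : ℤ) (hv : Odd v) (hs : s = 1 ∨ s = -1) (hc : (8 : ℤ) ∣ c) :
    1 + 8 * (if ¬ (Odd (v / 2) ↔ Odd (v / 2 / 2)) then 1 else 0 : ℤ) ≤ (v - c * s) ^ 2 := by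
  obtain ⟨t, ht⟩ := hc
  subst ht
  have hw : Odd (v - 8 * t * s) := by
    have : Even (8 * t * s) := ⟨4 * t * s, by ring⟩
    exact Int.odd_sub.2 (iff_of_true hv this)
  have key := z2_pt_core (v - 8 * t * s) hw
  have hv1 := Int.odd_iff.1 hv
  have e1 : (Odd ((v - 8 * t * s) / 2) ↔ Odd (v / 2)) := by
    rw [Int.odd_iff, Int.odd_iff]; rcases hs with rfl | rfl <;> omega
  have e2 : (Odd ((v - 8 * t * s) / 2 / 2) ↔ Odd (v / 2 / 2)) := by
    rw [Int.odd_iff, Int.odd_iff]; rcases hs with rfl | rfl <;> omega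
  simp only [e1, e2] at key
  exact key

/-- `|v − c s| = 1` with `4 ∣ c s` ⇒ `v − c s = (−1)^{[⌊v/2⌋ odd]}`. [folklore] -/
theorem z2_tau_one {v c s : ℤ} (hc : (4 : ℤ) ∣ c * s) (h : v - c * s = 1 ∨ v - c * s = -1) :
    v - c * s = sZ (decide (Odd (v / 2))) := by
  obtain ⟨t, ht⟩ := hc
  rw [ht] at h ⊢
  rcases h with h | h
  · have hv : v / 2 = 2 * t := by omega
    have hev : ¬ Odd (v / 2) := by rw [hv, Int.not_odd_iff_even]; exact ⟨t, by ring⟩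
    rw [h, decide_eq_false hev]; rfl
  · have hv : v / 2 = 2 * t - 1 := by omega
    have hod : Odd (v / 2) := by rw [hv]; exact ⟨t - 1, by ring⟩
    rw [h, decide_eq_true hod]; rfl

/-- `(v − c s)² = 9` with `4 ∣ c s` ⇒ `v − c s = −3·(−1)^{[⌊v/2⌋ odd]}`. [folklore] -/
theorem z2_tau_three {v c s : ℤ} (hc : (4 : ℤ) ∣ c * s) (h : (v - c * s) ^ 2 = 9) :
    v - c * s = -3 * sZ (decide (Odd (v / 2))) := by
  obtain ⟨t, ht⟩ := hc
  rw [ht] at h ⊢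
  have h3 : v - 4 * t = 3 ∨ v - 4 * t = -3 := by
    have : (v - 4 * t - 3) * (v - 4 * t + 3) = 0 := by nlinarith
    rcases mul_eq_zero.1 this with h1 | h1
    · left; linarith
    · right; linarith
  rcases h3 with h3 | h3
  · have hv : v / 2 = 2 * t + 1 := by omega
    have hod : Odd (v / 2) := by rw [hv]; exact ⟨t, rfl⟩
    rw [h3, decide_eq_true hod]; rfl
  · have hv : v / 2 = 2 * t - 2 := by omega
    have hev : ¬ Odd (v / 2) := by rw [hv, Int.not_odd_iff_even]; exact ⟨t - 1, by ring⟩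
    rw [h3, decide_eq_false hev]; rfl

/-- `¬ (p ↔ q)` ⇒ `decide p ⊕ decide q = true`. [folklore] -/
theorem z2_xor_decide_of_not_iff {p q : Prop} [Decidable p] [Decidable q] (h : ¬ (p ↔ q)) :
    (decide p ^^ decide q) = true := by
  by_cases hp : p <;> by_cases hq : q <;> simp [hp, hq] at h ⊢

/-! ### The type-O configuration at the second boundary on `6r` bits -/

/-- **A type-O cubic on `6r` bits never reaches `Φ = 1 − 2^{−2r}` (`r ≥ 3`).**  For cubic `f, g : 𝔽₂^{3r+3r} → 𝔽₂` with `W_g = 2^{2r}u` and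
every `u(x)` odd: `Φ(f,g) < 1 − (1/2)^{2r}` (two-sided: budget ⇒ residual `(−1)^{d₁}(1 − 4·1_A)` with `d₁` affine and `A` a `(6r−3)`-flat; few
frequencies vs the pairing `2^{8r}`).  Uniform in `r`; NOT summit progress. [this work] -/
theorem z2_typeO_lt (r : ℕ) (hr : 3 ≤ r) (f g : (Fin (3 * r + 3 * r) → Bool) → Bool) (hf : IsDegLeFun 3 f) (hg : IsDegLeFun 3 g)
    (u : (Fin (3 * r + 3 * r) → Bool) → ℤ) (hu : ∀ x, W (fun y => signOf (g y)) x = (2 : ℝ) ^ (2 * r) * (u x : ℝ))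
    (hodd : ∀ x, Odd (u x)) : forrelation f g < 1 - (1 / 2 : ℝ) ^ (2 * r) := by
  classical
  by_contra hge
  push Not at hge
  have hnoA : ¬ (∀ x, Odd (u x / 2) ↔ Odd (u x / 2 / 2)) := z2_no_caseA r g u (by omega) hg hu hodd
  obtain ⟨k, rfl⟩ : ∃ k, r = k + 3 := ⟨r - 3, by omega⟩
  have hd1 : IsDegLeFun 1 (fun x => decide (Odd (u x / 2))) := z2_digitOne (k + 3) g u hg hu hodd
  have hd2 : IsDegLeFun 3 (fun x => decide (Odd (u x / 2 / 2))) := z2_digitTwo (k + 3) g u hg hu hodd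
  set A := univ.filter (fun x : Fin (3 * (k + 3) + 3 * (k + 3)) → Bool => ¬ (Odd (u x / 2) ↔ Odd (u x / 2 / 2))) with hAdef
  have hmemA : ∀ x, x ∈ A ↔ ¬ (Odd (u x / 2) ↔ Odd (u x / 2 / 2)) := fun x => by simp [hAdef]
  -- `A` as the support of the degree-3 function `d₁ ⊕ d₂`
  have hdegA : IsDegLeFun (2 + 1) (fun x => decide (Odd (u x / 2)) ^^ decide (Odd (u x / 2 / 2))) :=
    bb_isDegLeFun_bxor (hd1.mono (by norm_num)) hd2
  have hsetA : (univ.filter fun x : Fin (3 * (k + 3) + 3 * (k + 3)) → Bool =>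
      (decide (Odd (u x / 2)) ^^ decide (Odd (u x / 2 / 2))) = true) = A := by
    rw [hAdef]
    apply filter_congr
    intro x _
    by_cases h1 : Odd (u x / 2) <;> by_cases h2 : Odd (u x / 2 / 2) <;> simp [h1, h2]
  have hne : ∃ x, (decide (Odd (u x / 2)) ^^ decide (Odd (u x / 2 / 2))) = true := by
    by_contra hnone
    push Not at hnone
    refine hnoA fun x => ?_
    have hx := hnone x
    by_cases h1 : Odd (u x / 2) <;> by_cases h2 : Odd (u x / 2 / 2) <;> simp [h1, h2] at hx ⊢
  have hrm := bb_rmWeight_holds (3 * (k + 3) + 3 * (k + 3)) 3 _ (hdegA) hne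
  rw [hsetA] at hrm
  have hAge : 2 ^ (6 * k + 15) ≤ #A := by
    have h2 : (2 : ℕ) ^ (3 * (k + 3) + 3 * (k + 3)) = 2 ^ 3 * 2 ^ (6 * k + 15) := by ring
    rw [h2] at hrm
    exact Nat.le_of_mul_le_mul_left hrm (by positivity)
  -- budget and the pointwise cost
  have hbud := zms_budget (k + 3) f g u hu
  have hpow : (2 : ℝ) ^ (8 * (k + 3) + 1) * (1 / 2) ^ (2 * (k + 3)) = 2 ^ (6 * k + 19) := by
    rw [one_div_pow]; field_simp; ring
  have hT : (∑ x, (u x - 2 ^ (k + 3) * sZ (f x)) ^ 2 : ℤ) ≤ 2 ^ (6 * k + 19) := by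
    have h1 : 1 - forrelation f g ≤ (1 / 2 : ℝ) ^ (2 * (k + 3)) := by linarith
    have h' : ((∑ x, (u x - 2 ^ (k + 3) * sZ (f x)) ^ 2 : ℤ) : ℝ) ≤ (2 : ℝ) ^ (6 * k + 19) := by
      rw [hbud, ← hpow]
      exact mul_le_mul_of_nonneg_left h1 (by positivity)
    exact_mod_cast h'
  have hsumA : (∑ x, (if ¬ (Odd (u x / 2) ↔ Odd (u x / 2 / 2)) then 1 else 0 : ℤ)) = #A := by rw [sum_boole]
  have h8c : (8 : ℤ) ∣ 2 ^ (k + 3) := ⟨2 ^ k, by ring⟩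
  have h4c : ∀ x, (4 : ℤ) ∣ 2 ^ (k + 3) * sZ (f x) := fun x => ⟨2 ^ (k + 1) * sZ (f x), by ring⟩
  have hnonneg : ∀ x, 0 ≤ (u x - 2 ^ (k + 3) * sZ (f x)) ^ 2 -
      (1 + 8 * (if ¬ (Odd (u x / 2) ↔ Odd (u x / 2 / 2)) then 1 else 0 : ℤ)) :=
    fun x => by have := z2_pt (u x) (sZ (f x)) (2 ^ (k + 3)) (hodd x) (tp_sZ_cases (f x)) h8c; linarith
  have hNcard : (#(univ : Finset (Fin (3 * (k + 3) + 3 * (k + 3)) → Bool)) : ℤ) = 2 ^ (6 * k + 18) := by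
    rw [card_univ, Fintype.card_fun, Fintype.card_bool, Fintype.card_fin]; push_cast; ring
  have hsum1 : ∑ x, (1 + 8 * (if ¬ (Odd (u x / 2) ↔ Odd (u x / 2 / 2)) then 1 else 0 : ℤ)) = 2 ^ (6 * k + 18) + 8 * #A := by
    rw [sum_add_distrib, ← mul_sum, hsumA, sum_const, nsmul_eq_mul, mul_one, hNcard]
  have hAge' : (2 : ℤ) ^ (6 * k + 15) ≤ #A := by exact_mod_cast hAge
  have hsplitN : (2 : ℤ) ^ (6 * k + 19) = 2 ^ (6 * k + 18) + 8 * 2 ^ (6 * k + 15) := by ring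
  have hsum0 : ∑ x, ((u x - 2 ^ (k + 3) * sZ (f x)) ^ 2 -
      (1 + 8 * (if ¬ (Odd (u x / 2) ↔ Odd (u x / 2 / 2)) then 1 else 0 : ℤ))) = 0 := by
    refine le_antisymm ?_ (sum_nonneg fun x _ => hnonneg x)
    rw [sum_sub_distrib, hsum1]
    linarith
  have hpt : ∀ x, (u x - 2 ^ (k + 3) * sZ (f x)) ^ 2 = 1 + 8 * (if ¬ (Odd (u x / 2) ↔ Odd (u x / 2 / 2)) then 1 else 0 : ℤ) :=
    fun x => by have := (sum_eq_zero_iff_of_nonneg fun y _ => hnonneg y).1 hsum0 x (mem_univ x); linarith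
  have hTval : (∑ x, (u x - 2 ^ (k + 3) * sZ (f x)) ^ 2 : ℤ) = 2 ^ (6 * k + 18) + 8 * #A := by
    rw [sum_congr rfl fun x _ => hpt x, hsum1]
  have hAcard : #A = 2 ^ (6 * k + 15) := by
    have hle : #A ≤ 2 ^ (6 * k + 15) := by
      have : (#A : ℤ) ≤ 2 ^ (6 * k + 15) := by rw [hTval] at hT; linarith
      exact_mod_cast this
    exact le_antisymm hle hAge
  have hTeq : (2 : ℝ) ^ (8 * (k + 3) + 1) * (1 - forrelation f g) = 2 ^ (6 * k + 19) := by
    have e : (∑ x, (u x - 2 ^ (k + 3) * sZ (f x)) ^ 2 : ℤ) = 2 ^ (6 * k + 19) := by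
      rw [hTval, hAcard, hsplitN]; push_cast; ring
    have h : ((∑ x, (u x - 2 ^ (k + 3) * sZ (f x)) ^ 2 : ℤ) : ℝ) = 2 ^ (6 * k + 19) := by exact_mod_cast e
    rw [hbud] at h
    exact h
  -- the residual
  have hτ1 : ∀ x, x ∉ A → u x - 2 ^ (k + 3) * sZ (f x) = sZ (decide (Odd (u x / 2))) := by
    intro x hx
    have h := hpt x
    rw [if_neg (fun h' => hx ((hmemA x).2 h'))] at h
    have h1 : (u x - 2 ^ (k + 3) * sZ (f x)) * (u x - 2 ^ (k + 3) * sZ (f x)) = 1 := by rw [← pow_two]; linarith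
    exact z2_tau_one (h4c x) (mul_self_eq_one_iff.1 h1)
  have hτ3 : ∀ x, x ∈ A → u x - 2 ^ (k + 3) * sZ (f x) = -3 * sZ (decide (Odd (u x / 2))) := by
    intro x hx
    have h := hpt x
    rw [if_pos ((hmemA x).1 hx)] at h
    exact z2_tau_three (h4c x) (by linarith)
  -- `A` is a `(6r−3)`-flat
  have hmwA := mw_flat_of_minweight 2 _ hdegA (by rw [hsetA, hAcard]; ring)
  rw [hsetA] at hmwA
  obtain ⟨h0A, haddA, hcardVA, hcosetA⟩ := hmwA
  set VA := univ.filter (fun a : Fin (3 * (k + 3) + 3 * (k + 3)) → Bool => ∀ x,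
    (decide (Odd (u (bxor x a) / 2)) ^^ decide (Odd (u (bxor x a) / 2 / 2))) =
      (decide (Odd (u x / 2)) ^^ decide (Odd (u x / 2 / 2)))) with hVA
  rw [hAcard] at hcardVA
  obtain ⟨xA, hxA⟩ : A.Nonempty := by rw [← card_pos, hAcard]; positivity
  have hSA : A = VA.image (bxor xA) := hcosetA xA (z2_xor_decide_of_not_iff ((hmemA xA).1 hxA))
  -- `d₁` is affine: every translation is a period up to sign of `(−1)^{d₁}`
  have hDconst : ∀ a x : Fin (3 * (k + 3) + 3 * (k + 3)) → Bool,
      decide (Odd (u (bxor x a) / 2)) = (decide (Odd (u x / 2)) ^^ (decide (Odd (u zeroVec / 2)) ^^ decide (Odd (u a / 2)))) := by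
    intro a x
    have hc := tc_const_of_deg_zero (stub_derivDegree (3 * (k + 3) + 3 * (k + 3)) 0 (fun x => decide (Odd (u x / 2))) a hd1)
      x zeroVec
    simp only [zeroVec_bxor] at hc
    revert hc
    cases decide (Odd (u (bxor x a) / 2)) <;> cases decide (Odd (u x / 2)) <;> cases decide (Odd (u zeroVec / 2)) <;>
      cases decide (Odd (u a / 2)) <;> decide
  set A₁ : (Fin (3 * (k + 3) + 3 * (k + 3)) → Bool) → ℝ := fun x => signOf (decide (Odd (u x / 2))) with hA₁
  set A₂ : (Fin (3 * (k + 3) + 3 * (k + 3)) → Bool) → ℝ :=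
    fun x => if x ∈ A then signOf (decide (Odd (u x / 2))) else 0 with hA₂
  have hN : (#(univ : Finset (Fin (3 * (k + 3) + 3 * (k + 3)) → Bool)) : ℝ) = 2 ^ (3 * (k + 3) + 3 * (k + 3)) := by
    rw [card_univ, Fintype.card_fun, Fintype.card_bool, Fintype.card_fin]; push_cast; ring
  have h1b := fp_l1_sq_mul_le A₁ univ univ (fun x _ => by simp only [A₁]; unfold signOf; split_ifs <;> simp)
    (fun x hx => absurd (mem_univ x) hx) (mem_univ _) (fun a _ b _ => mem_univ _) (fun a _ => by
      refine ⟨signOf (decide (Odd (u zeroVec / 2)) ^^ decide (Odd (u a / 2))), ?_, fun x => ?_⟩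
      · unfold signOf; split_ifs <;> simp
      · simp only [A₁]; rw [hDconst a x, signOf_xor]; ring)
  rw [hN] at h1b
  have hX : ∑ y, |W A₁ y| ≤ (2 : ℝ) ^ (3 * (k + 3) + 3 * (k + 3)) := by
    have hnn : 0 ≤ ∑ y, |W A₁ y| := sum_nonneg fun y _ => abs_nonneg _
    have hpos : (0 : ℝ) < 2 ^ (3 * (k + 3) + 3 * (k + 3)) := by positivity
    have h2 : (∑ y, |W A₁ y|) ^ 2 ≤ ((2 : ℝ) ^ (3 * (k + 3) + 3 * (k + 3))) ^ 2 := by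
      have h3 : (∑ y, |W A₁ y|) ^ 2 * 2 ^ (3 * (k + 3) + 3 * (k + 3)) ≤
          ((2 : ℝ) ^ (3 * (k + 3) + 3 * (k + 3))) ^ 2 * 2 ^ (3 * (k + 3) + 3 * (k + 3)) :=
        h1b.trans_eq (by ring)
      exact le_of_mul_le_mul_right h3 hpos
    exact (pow_le_pow_iff_left₀ hnn hpos.le two_ne_zero).1 h2
  have h2b := fp_l1_sq_mul_le A₂ A VA (fun x hx => by
      simp only [A₂, if_pos hx]; unfold signOf; split_ifs <;> simp) (fun x hx => by simp only [A₂, if_neg hx]) h0A haddA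
    (fun a ha => by
      refine ⟨signOf (decide (Odd (u zeroVec / 2)) ^^ decide (Odd (u a / 2))), ?_, fun x => ?_⟩
      · unfold signOf; split_ifs <;> simp
      · by_cases hx : x ∈ A
        · have hxa : bxor x a ∈ A := fl1_coset_vadd haddA hSA hx ha
          simp only [A₂, if_pos hx, if_pos hxa]; rw [hDconst a x, signOf_xor]; ring
        · have hxa : bxor x a ∉ A := fl1_coset_out' haddA hSA hx ha
          simp only [A₂, if_neg hx, if_neg hxa, mul_zero])
  rw [hcardVA, hAcard] at h2b
  have hY : ∑ y, |W A₂ y| ≤ (2 : ℝ) ^ (3 * (k + 3) + 3 * (k + 3)) := by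
    have hnn : 0 ≤ ∑ y, |W A₂ y| := sum_nonneg fun y _ => abs_nonneg _
    have hpos : (0 : ℝ) < 2 ^ (3 * (k + 3) + 3 * (k + 3)) := by positivity
    have hposA : (0 : ℝ) < ((2 ^ (6 * k + 15) : ℕ) : ℝ) := by positivity
    have h2 : (∑ y, |W A₂ y|) ^ 2 ≤ ((2 : ℝ) ^ (3 * (k + 3) + 3 * (k + 3))) ^ 2 := by
      have h3 : (∑ y, |W A₂ y|) ^ 2 * ((2 ^ (6 * k + 15) : ℕ) : ℝ) ≤
          ((2 : ℝ) ^ (3 * (k + 3) + 3 * (k + 3))) ^ 2 * ((2 ^ (6 * k + 15) : ℕ) : ℝ) :=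
        h2b.trans_eq (by ring)
      exact le_of_mul_le_mul_right h3 hposA
    exact (pow_le_pow_iff_left₀ hnn hpos.le two_ne_zero).1 h2
  -- decomposition and pairing
  have hdecomp : (fun x => (u x : ℝ) - (2 : ℝ) ^ (k + 3) * signOf (f x)) = fun x => A₁ x + (-4) * A₂ x := by
    funext x
    have e : (u x : ℝ) - (2 : ℝ) ^ (k + 3) * signOf (f x) = (((u x - 2 ^ (k + 3) * sZ (f x) : ℤ)) : ℝ) := by
      push_cast; rw [tp_sZ_cast]
    rw [e]
    by_cases hx : x ∈ A
    · simp only [A₁, A₂, if_pos hx]; rw [hτ3 x hx]; push_cast; rw [tp_sZ_cast]; ring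
    · simp only [A₁, A₂, if_neg hx]; rw [hτ1 x hx, tp_sZ_cast]; ring
  have hpair := zms_pairing (k + 3) f g u hu
  rw [hdecomp] at hpair
  have hP : ∑ y, signOf (g y) * W (fun x => A₁ x + (-4) * A₂ x) y = (2 : ℝ) ^ (8 * k + 24) := by
    rw [hpair, show (2 : ℝ) ^ (10 * (k + 3)) = 2 ^ (2 * k + 5) * 2 ^ (8 * (k + 3) + 1) by ring, mul_assoc, hTeq]
    ring
  have e2 : ∀ y, signOf (g y) * W (fun x => A₁ x + (-4) * A₂ x) y =
      signOf (g y) * W A₁ y + (-4) * (signOf (g y) * W A₂ y) := fun y => by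
    rw [sp_W_add, fl1_W_smul]; ring
  rw [sum_congr rfl fun y _ => e2 y, sum_add_distrib, ← mul_sum] at hP
  have hP1 : ∑ y, signOf (g y) * W A₁ y ≤ ∑ y, |W A₁ y| := fl1_pairing_le_l1 g (W A₁)
  have hP2 : |∑ y, signOf (g y) * W A₂ y| ≤ ∑ y, |W A₂ y| :=
    (abs_sum_le_sum_abs _ _).trans (sum_le_sum fun y _ => by
      rw [abs_mul]; unfold signOf; split_ifs <;> norm_num)
  have hP2' := (abs_le.1 hP2).1
  have hbig : (64 : ℝ) * 2 ^ (3 * (k + 3) + 3 * (k + 3)) ≤ 2 ^ (8 * k + 24) := by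
    have e64 : (2 : ℝ) ^ (8 * k + 24) = 2 ^ (2 * k) * (64 * 2 ^ (3 * (k + 3) + 3 * (k + 3))) := by ring
    rw [e64]
    have h1 : (1 : ℝ) ≤ 2 ^ (2 * k) := one_le_pow₀ (by norm_num)
    have h2 : (0 : ℝ) ≤ 64 * 2 ^ (3 * (k + 3) + 3 * (k + 3)) := by positivity
    exact le_mul_of_one_le_left h2 h1
  have hpos : (0 : ℝ) < 2 ^ (3 * (k + 3) + 3 * (k + 3)) := by positivity
  linarith

end Summit.QuantumAdvantage.QuantumAdvantage.Theorems.CubicForrelation.NearExactIsExact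

end
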